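import Literature.Topology.FourManifolds.KirbyMovesSlideEndArcTopology
import Literature.Topology.FourManifolds.KirbyMovesSlideEndFlatModel
import Literature.Topology.FourManifolds.KirbyMovesSlideEndStepA
import Mathlib.Geometry.Manifold.PartitionOfUnity
import HarnessLib

/-!
# Normalising the band end, step B: the straightening map in the chart

Topic `Literature/Topology/FourManifolds`; fact seat `provefact-IsStrictHandleSlide.isSurgery`
(R. C. Kirby, *The Topology of 4-Manifolds*, LNM 1374 (1989), Ch. I §4; remaining content: the
named fact (S) `Literature.Topology.FourManifolds.FramedLink.IsStrictHandleSlide.slideModel`).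
The flattening of the band end at the push-off `Kⱼ'` is obtained, as in the uniqueness of
tubular neighbourhoods (Kosinski (1993), III.(3.5); the tree's `LinkTubularUniqueness.lean`), from
the straight-line isotopy extension applied in a chart `σ : S³ ⊇ U ≅ ℝ³` to a **straightening
map** `P = id + ρ • (Q - id)`: `Q = (σ ∘ thickeningFlat) ∘ (σ ∘ thickening)⁻¹` straightens the
thickening of the band end onto its flat model near the attaching arc, and `ρ` is a plateau
function localising to a neighbourhood of the arc segment. This file constructs `P` and proves
the hypotheses of `exists_diffeomorph_eqOn_nhdsSet_of_straightLine_of_subset`: `P` is smooth,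
fixes `σ(Kⱼ')` pointwise, has derivatives `D` along `σ(Kⱼ')` all of whose straight-line
combinations `id + t (D - id)` are injective, and carries `σ (band x)` to `σ (thickeningFlat (x, 0))`
for `x` in an open set containing the edge segment. Proved here (no definitions, no named facts):

* `BandCore.exists_straighteningMap`.

## References

* R. C. Kirby, *The Topology of 4-Manifolds*, LNM 1374, Springer (1989), Ch. I §4. [Kirby1989]
* A. Kosinski, *Differential Manifolds* (1993), Ch. III, Thm. (3.5). [Kosinski1993]
* M. W. Hirsch, *Differential Topology* (1976), Ch. 8 §1, Thm. 1.3. [HirschDT1976]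
-/

open scoped Manifold ContDiff Topology
open Function Set Metric Filter

noncomputable section

namespace Literature.Topology.FourManifolds

namespace BandCore

variable [Knot.TubularNbhd.SmoothnessFacts] {A Kj : Knot} (ν : Knot.TubularNbhd Kj)
  {avoid : Set (Metric.sphere (0 : EuclideanSpace ℝ (Fin 4)) 1)} (b : BandCore A ν.pushOff avoid)
  {σ : OpenPartialHomeomorph (Metric.sphere (0 : EuclideanSpace ℝ (Fin 4)) 1) (EuclideanSpace ℝ (Fin 3))}

/-- The coordinates of the flat model are `C^∞` on the strip `1/10 < x₁ < 9/10`. [folklore] -/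
theorem contDiffOn_thickeningFlatCoord :
    ContDiffOn ℝ ∞ (fun p : EuclideanSpace ℝ (Fin 2) × ℝ ↦
      ((b.thetaB (p.1 1), (1 + (1 - p.1 0) * b.edgeRate ν (p.1 1)) • framingBaseVector +
        p.2 • EuclideanSpace.single (1 : Fin 2) (1 : ℝ)) : ℝ × EuclideanSpace ℝ (Fin 2)))
      {p | p.1 1 ∈ Ioo (10⁻¹ : ℝ) (9 / 10)} := by
  have hx1 : ContDiff ℝ ∞ (fun p : EuclideanSpace ℝ (Fin 2) × ℝ ↦ p.1 1) :=
    (contDiff_euclidean.1 contDiff_id 1).comp contDiff_fst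
  have hx0 : ContDiff ℝ ∞ (fun p : EuclideanSpace ℝ (Fin 2) × ℝ ↦ p.1 0) :=
    (contDiff_euclidean.1 contDiff_id 0).comp contDiff_fst
  have hth : ContDiffOn ℝ ∞ (fun p : EuclideanSpace ℝ (Fin 2) × ℝ ↦ b.thetaB (p.1 1)) {p | p.1 1 ∈ Ioo (10⁻¹ : ℝ) (9 / 10)} :=
    fun p hp ↦ ((b.contDiffAt_thetaB hp).comp p hx1.contDiffAt).contDiffWithinAt
  have hκ : ContDiffOn ℝ ∞ (fun p : EuclideanSpace ℝ (Fin 2) × ℝ ↦ b.edgeRate ν (p.1 1)) {p | p.1 1 ∈ Ioo (10⁻¹ : ℝ) (9 / 10)} :=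
    (b.contDiffOn_edgeRate ν).comp hx1.contDiffOn fun p hp ↦ hp
  have hr : ContDiffOn ℝ ∞ (fun p : EuclideanSpace ℝ (Fin 2) × ℝ ↦ 1 + (1 - p.1 0) * b.edgeRate ν (p.1 1))
      {p | p.1 1 ∈ Ioo (10⁻¹ : ℝ) (9 / 10)} :=
    contDiffOn_const.add ((contDiffOn_const.sub hx0.contDiffOn).mul hκ)
  exact hth.prodMk ((hr.smul contDiffOn_const).add (contDiff_snd.smul contDiff_const).contDiffOn)

/-- The flat model read in the chart is `C^∞` on the strip `1/10 < x₁ < 9/10`. [folklore] -/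
theorem contDiffOn_thickeningFlatChart (hσ : ContMDiffOn (𝓡 3) 𝓘(ℝ, EuclideanSpace ℝ (Fin 3)) ∞ σ σ.source)
    (hνσ : ∀ q, ν q ∈ σ.source) :
    ContDiffOn ℝ ∞ (fun p : EuclideanSpace ℝ (Fin 2) × ℝ ↦ σ (b.thickeningFlat ν p))
      {p | p.1 1 ∈ Ioo (10⁻¹ : ℝ) (9 / 10)} := by
  have hF := contDiffOn_tubeChart ν hσ
  have hΞ := b.contDiffOn_thickeningFlatCoord ν
  have hmaps : MapsTo (fun p : EuclideanSpace ℝ (Fin 2) × ℝ ↦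
      ((b.thetaB (p.1 1), (1 + (1 - p.1 0) * b.edgeRate ν (p.1 1)) • framingBaseVector +
        p.2 • EuclideanSpace.single (1 : Fin 2) (1 : ℝ)) : ℝ × EuclideanSpace ℝ (Fin 2)))
      {p | p.1 1 ∈ Ioo (10⁻¹ : ℝ) (9 / 10)} {q : ℝ × EuclideanSpace ℝ (Fin 2) | ν (circlePt q.1, q.2) ∈ σ.source} :=
    fun p _ ↦ hνσ _
  have h := hF.comp hΞ hmaps
  have hfun : (fun p : EuclideanSpace ℝ (Fin 2) × ℝ ↦ σ (b.thickeningFlat ν p)) =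
      (fun q : ℝ × EuclideanSpace ℝ (Fin 2) ↦ σ (ν (circlePt q.1, q.2))) ∘
        (fun p : EuclideanSpace ℝ (Fin 2) × ℝ ↦
          ((b.thetaB (p.1 1), (1 + (1 - p.1 0) * b.edgeRate ν (p.1 1)) • framingBaseVector +
            p.2 • EuclideanSpace.single (1 : Fin 2) (1 : ℝ)) : ℝ × EuclideanSpace ℝ (Fin 2))) := by
    funext p; rfl
  rw [hfun]
  exact h

/-- **The straightening map.** See the module docstring. Hypotheses: a chart `σ` of `S³` to `ℝ³`
(smooth with smooth inverse) containing `ν (S¹ × ℝ²)`; heights `1/10 < h₁ - ε`, `h₁ ≤ h₂`,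
`h₂ + ε < 9/10`, `0 < ε`; along `[h₁ - ε, h₂ + ε]` the band leaves the push-off radially:
`D W (1, y) (1, 0) = -κ(y) • e₀` with `κ(y) = edgeRate y > 0` (the output of step A).
[cite: Kosinski1993, Ch. III Thm (3.5)] -/
theorem exists_straighteningMap (hσ : ContMDiffOn (𝓡 3) 𝓘(ℝ, EuclideanSpace ℝ (Fin 3)) ∞ σ σ.source)
    (hσs : ContMDiff 𝓘(ℝ, EuclideanSpace ℝ (Fin 3)) (𝓡 3) ∞ σ.symm) (hνσ : ∀ q, ν q ∈ σ.source)
    {h₁ h₂ ε : ℝ} (hε : 0 < ε) (hlo : 10⁻¹ < h₁ - ε) (hle : h₁ ≤ h₂) (hhi : h₂ + ε < 9 / 10)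
    (hA : ∀ y ∈ Icc (h₁ - ε) (h₂ + ε),
      fderiv ℝ (b.tubeNormal ν) (pt2 1 y) (pt2 1 0) = (-b.edgeRate ν y) • framingBaseVector)
    (hpos : ∀ y ∈ Icc (h₁ - ε) (h₂ + ε), 0 < b.edgeRate ν y) :
    ∃ (P : EuclideanSpace ℝ (Fin 3) → EuclideanSpace ℝ (Fin 3)) (G : Set (EuclideanSpace ℝ (Fin 2))),
      ContDiff ℝ ∞ P ∧ IsOpen G ∧ (∀ y ∈ Icc h₁ h₂, (pt2 1 y : EuclideanSpace ℝ (Fin 2)) ∈ G) ∧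
      G ⊆ b.baseLiftDom ν ∧
      (∀ u, P (σ (ν.pushOff u)) = σ (ν.pushOff u)) ∧
      (∀ u, ∃ D : EuclideanSpace ℝ (Fin 3) →L[ℝ] EuclideanSpace ℝ (Fin 3),
        HasFDerivAt P D (σ (ν.pushOff u)) ∧ ∀ t ∈ Icc (0 : ℝ) 1, Injective (slDeriv t D)) ∧
      ∀ x ∈ G, P (σ (b.band x)) = σ (b.thickeningFlat ν (x, 0)) := by
  -- the chart maps `f = σ ∘ thickening`, `f♭ = σ ∘ thickeningFlat`
  obtain ⟨f, hf⟩ : ∃ f : EuclideanSpace ℝ (Fin 2) × ℝ → EuclideanSpace ℝ (Fin 3),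
      f = fun p ↦ σ (b.thickening ν p) := ⟨_, rfl⟩
  obtain ⟨fb, hfb⟩ : ∃ fb : EuclideanSpace ℝ (Fin 2) × ℝ → EuclideanSpace ℝ (Fin 3),
      fb = fun p ↦ σ (b.thickeningFlat ν p) := ⟨_, rfl⟩
  -- the inverse chart near the segment over `[h₁ - ε, h₂ + ε]`
  have hc : ∀ y ∈ Icc (h₁ - ε) (h₂ + ε), b.edgeRate ν y ≠ 0 := fun y hy ↦ (hpos y hy).ne'
  obtain ⟨N, Φ, hNo, hKN, hND, hΦf, hΦs, hΦt, hopen, hsymm⟩ :=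
    b.exists_thickeningChart_inverse ν hσ hσs hνσ hlo hhi hc hA
  rw [← hf] at hΦf hΦt hopen hsymm
  have hyI : ∀ y ∈ Icc (h₁ - ε) (h₂ + ε), y ∈ Ioo (10⁻¹ : ℝ) (9 / 10) := fun y hy ↦ ⟨by linarith [hy.1], by linarith [hy.2]⟩
  have hedgeN : ∀ y ∈ Icc (h₁ - ε) (h₂ + ε), ((pt2 1 y : EuclideanSpace ℝ (Fin 2)), (0 : ℝ)) ∈ N :=
    fun y hy ↦ hKN ⟨y, hy, rfl⟩
  have hfedge : ∀ y ∈ Icc (h₁ - ε) (h₂ + ε), f (pt2 1 y, 0) = σ (ν.pushOff (circlePt (b.thetaB y))) := by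
    intro y hy; rw [hf]; simp only [b.thickening_pt2_one_zero ν (Ioo_subset_Icc_self (hyI y hy))]
  have hfbedge : ∀ y, fb (pt2 1 y, 0) = σ (ν.pushOff (circlePt (b.thetaB y))) := by
    intro y; rw [hfb]; simp only [b.thickeningFlat_pt2_one_zero ν]
  have hΦsymm_edge : ∀ y ∈ Icc (h₁ - ε) (h₂ + ε), Φ.symm (f (pt2 1 y, 0)) = (pt2 1 y, 0) := by
    intro y hy
    have h := Φ.left_inv (show ((pt2 1 y : EuclideanSpace ℝ (Fin 2)), (0 : ℝ)) ∈ Φ.source by rw [hΦs]; exact hedgeN y hy)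
    rwa [hΦf] at h
  have hfN_target : ∀ p ∈ N, f p ∈ Φ.target := fun p hp ↦ by
    rw [hΦt]; exact ⟨p, hp, rfl⟩
  -- the compact segment image `K₀` over `[h₁, h₂]` and the compact rest `C`
  set K₀ : Set (EuclideanSpace ℝ (Fin 3)) := f '' ((fun y : ℝ ↦ ((pt2 1 y : EuclideanSpace ℝ (Fin 2)), (0 : ℝ))) '' Icc h₁ h₂) with hK₀
  have hline : Continuous (fun y : ℝ ↦ ((pt2 1 y : EuclideanSpace ℝ (Fin 2)), (0 : ℝ))) := by
    have : ContDiff ℝ ∞ (fun y : ℝ ↦ (pt2 1 y : EuclideanSpace ℝ (Fin 2))) := by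
      rw [contDiff_euclidean]; intro i; fin_cases i
      · exact contDiff_const
      · exact contDiff_id
    exact this.continuous.prodMk continuous_const
  have hfcont : ContinuousOn f N := by
    rw [hf]; exact ((b.contDiffOn_thickeningChart ν hσ hνσ).continuousOn).mono hND
  have hsub12 : Icc h₁ h₂ ⊆ Icc (h₁ - ε) (h₂ + ε) := Icc_subset_Icc (by linarith) (by linarith)
  have hK₀c : IsCompact K₀ := by
    refine ((isCompact_Icc.image hline).image_of_continuousOn (hfcont.mono ?_))
    rintro _ ⟨y, hy, rfl⟩; exact hedgeN y (hsub12 hy)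
  have hK₀t : K₀ ⊆ Φ.target := by
    rintro _ ⟨_, ⟨y, hy, rfl⟩, rfl⟩; exact hfN_target _ (hedgeN y (hsub12 hy))
  set C : Set (EuclideanSpace ℝ (Fin 3)) :=
    σ '' (ν.pushOff '' (circlePt '' Icc (b.thetaB (h₁ - ε)) (b.thetaB (h₂ + ε) + 1))) with hC
  have hCc : IsCompact C := isCompact_pushOffRest ν hσ hνσ _ _
  have hK₀C : Disjoint K₀ C := by
    refine disjoint_left.2 ?_
    rintro _ ⟨_, ⟨y, hy, rfl⟩, rfl⟩ hmem
    have h := b.thickening_segment_not_mem_rest ν hνσ hε hlo.le hhi.le hy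
    rw [hf] at hmem
    exact h hmem
  -- the localising plateau `ρ`
  set Uρ : Set (EuclideanSpace ℝ (Fin 3)) := Φ.target ∩ Cᶜ with hUρ
  have hUρo : IsOpen Uρ := Φ.open_target.inter hCc.isClosed.isOpen_compl
  have hK₀U : K₀ ⊆ Uρ := fun z hz ↦ ⟨hK₀t hz, fun hzC ↦ disjoint_left.1 hK₀C hz hzC⟩
  obtain ⟨ρ, hρ0, hρ1, hρI⟩ := exists_contMDiffMap_zero_one_nhds_of_isClosed (I := 𝓘(ℝ, EuclideanSpace ℝ (Fin 3)))
    (n := (⊤ : ℕ∞)) hUρo.isClosed_compl hK₀c.isClosed (disjoint_compl_left_iff.2 hK₀U)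
  have hρs : ContDiff ℝ ∞ (ρ : EuclideanSpace ℝ (Fin 3) → ℝ) := ρ.contMDiff.contDiff
  obtain ⟨O₀, hO₀o, hUO₀, hρO₀⟩ := mem_nhdsSet_iff_exists.1 hρ0
  obtain ⟨O₁, hO₁o, hKO₁, hρO₁⟩ := mem_nhdsSet_iff_exists.1 hρ1
  -- `Q = f♭ ∘ Φ⁻¹` and the straightening map `P = id + ρ • (Q - id)`
  obtain ⟨Q, hQ⟩ : ∃ Q : EuclideanSpace ℝ (Fin 3) → EuclideanSpace ℝ (Fin 3), Q = fun z ↦ fb (Φ.symm z) := ⟨_, rfl⟩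
  obtain ⟨P, hP⟩ : ∃ P : EuclideanSpace ℝ (Fin 3) → EuclideanSpace ℝ (Fin 3), P = fun z ↦ z + ρ z • (Q z - z) := ⟨_, rfl⟩
  have hstrip : N ⊆ {p : EuclideanSpace ℝ (Fin 2) × ℝ | p.1 1 ∈ Ioo (10⁻¹ : ℝ) (9 / 10)} := fun p hp ↦ (hND hp).1.2.1
  have hfbs : ContDiffOn ℝ ∞ fb {p : EuclideanSpace ℝ (Fin 2) × ℝ | p.1 1 ∈ Ioo (10⁻¹ : ℝ) (9 / 10)} := by
    rw [hfb]; exact b.contDiffOn_thickeningFlatChart ν hσ hνσ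
  have hQs : ContDiffOn ℝ ∞ Q Φ.target := by
    rw [hQ, hΦt]
    refine hfbs.comp hsymm fun z hz ↦ hstrip ?_
    have := Φ.map_target (show z ∈ Φ.target by rw [hΦt]; exact hz)
    rwa [hΦs] at this
  -- `P = id` on `O₀`
  have hPO₀ : ∀ z ∈ O₀, P z = z := fun z hz ↦ by
    have h0 : ρ z = 0 := hρO₀ hz
    rw [hP]
    simp [h0]
  -- smoothness of `P`
  have hPs : ContDiff ℝ ∞ P := by
    rw [contDiff_iff_contDiffAt]
    intro z
    by_cases hz : z ∈ Φ.target
    · have hQz : ContDiffAt ℝ ∞ Q z := hQs.contDiffAt (Φ.open_target.mem_nhds hz)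
      rw [hP]
      exact contDiffAt_id.add (hρs.contDiffAt.smul (hQz.sub contDiffAt_id))
    · have hzO : z ∈ O₀ := hUO₀ (fun h ↦ hz h.1)
      have hev : P =ᶠ[𝓝 z] id := Filter.eventuallyEq_of_mem (hO₀o.mem_nhds hzO) fun w hw ↦ hPO₀ w hw
      exact contDiffAt_id.congr_of_eventuallyEq hev
  -- `Q` fixes the window arc, `ρ` vanishes on the rest: `P` fixes `σ(Kⱼ')`
  have hQwin : ∀ y ∈ Icc (h₁ - ε) (h₂ + ε), Q (σ (ν.pushOff (circlePt (b.thetaB y)))) = σ (ν.pushOff (circlePt (b.thetaB y))) := by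
    intro y hy
    rw [hQ]
    show fb (Φ.symm (σ (ν.pushOff (circlePt (b.thetaB y))))) = _
    rw [← hfedge y hy, hΦsymm_edge y hy, hfbedge]
    exact (hfedge y hy).symm
  have hPfix : ∀ u, P (σ (ν.pushOff u)) = σ (ν.pushOff u) := by
    intro u
    rcases b.pushOff_mem_window_or_rest ν (σ := σ) hlo.le hhi.le (by linarith) u with ⟨y, hy, hu⟩ | hrest
    · rw [hu, hP]
      simp only [hQwin y (Ioo_subset_Icc_self hy), sub_self, smul_zero, add_zero]
    · have hzU : σ (ν.pushOff u) ∉ Uρ := fun h ↦ h.2 hrest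
      exact hPO₀ _ (hUO₀ hzU)
  -- the open set `G` where the flattening holds
  set G : Set (EuclideanSpace ℝ (Fin 2)) := {x | ((x, (0 : ℝ)) : EuclideanSpace ℝ (Fin 2) × ℝ) ∈ N ∧ f (x, 0) ∈ O₁} with hG
  have hι : Continuous (fun x : EuclideanSpace ℝ (Fin 2) ↦ ((x, (0 : ℝ)) : EuclideanSpace ℝ (Fin 2) × ℝ)) :=
    continuous_id.prodMk continuous_const
  have hGo : IsOpen G := by
    have h1 : IsOpen {x : EuclideanSpace ℝ (Fin 2) | ((x, (0 : ℝ)) : EuclideanSpace ℝ (Fin 2) × ℝ) ∈ N} := hNo.preimage hι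
    have h2 : ContinuousOn (fun x : EuclideanSpace ℝ (Fin 2) ↦ f (x, 0)) {x | ((x, (0 : ℝ)) : EuclideanSpace ℝ (Fin 2) × ℝ) ∈ N} :=
      hfcont.comp hι.continuousOn fun x hx ↦ hx
    exact h2.isOpen_inter_preimage h1 hO₁o
  have hGseg : ∀ y ∈ Icc h₁ h₂, (pt2 1 y : EuclideanSpace ℝ (Fin 2)) ∈ G := fun y hy ↦
    ⟨hedgeN y (hsub12 hy), hKO₁ ⟨_, ⟨y, hy, rfl⟩, rfl⟩⟩
  have hGdom : G ⊆ b.baseLiftDom ν := fun x hx ↦ (hND hx.1).1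
  have hPflat : ∀ x ∈ G, P (σ (b.band x)) = σ (b.thickeningFlat ν (x, 0)) := by
    intro x hx
    have hxd : x ∈ b.baseLiftDom ν := hGdom hx
    have hfx : f (x, 0) = σ (b.band x) := by rw [hf]; simp only [b.thickening_zero ν hxd]
    have hsymmx : Φ.symm (f (x, 0)) = (x, 0) := by
      have h := Φ.left_inv (show ((x, (0 : ℝ)) : EuclideanSpace ℝ (Fin 2) × ℝ) ∈ Φ.source by rw [hΦs]; exact hx.1)
      rwa [hΦf] at h
    have hρ1x : ρ (f (x, 0)) = 1 := hρO₁ hx.2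
    rw [← hfx, hP]
    show f (x, 0) + ρ (f (x, 0)) • (Q (f (x, 0)) - f (x, 0)) = _
    rw [hρ1x, one_smul, add_sub_cancel, hQ]
    show fb (Φ.symm (f (x, 0))) = _
    rw [hsymmx, hfb]
  -- derivatives along `σ(Kⱼ')`
  have hderiv : ∀ u, ∃ D : EuclideanSpace ℝ (Fin 3) →L[ℝ] EuclideanSpace ℝ (Fin 3),
      HasFDerivAt P D (σ (ν.pushOff u)) ∧ ∀ t ∈ Icc (0 : ℝ) 1, Injective (slDeriv t D) := by
    intro u
    rcases b.pushOff_mem_window_or_rest ν (σ := σ) hlo.le hhi.le (by linarith) u with ⟨y, hy, hu⟩ | hrest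
    · -- on the window arc: `z = f (p₀)`, `p₀ = ((1, y), 0)`
      have hyc : y ∈ Icc (h₁ - ε) (h₂ + ε) := Ioo_subset_Icc_self hy
      have hyo : y ∈ Ioo (10⁻¹ : ℝ) (9 / 10) := hyI y hyc
      set z : EuclideanSpace ℝ (Fin 3) := σ (ν.pushOff u) with hz
      have hzf : z = f (pt2 1 y, 0) := by rw [hz, hu, hfedge y hyc]
      have hzt : z ∈ Φ.target := by rw [hzf]; exact hfN_target _ (hedgeN y hyc)
      have hQz : Q z = z := by rw [hz, hu]; exact hQwin y hyc
      -- the derivative of `f` at `p₀` as an equivalence and its formula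
      obtain ⟨L, hL⟩ := b.exists_equiv_hasFDerivAt_thickeningChart ν hσ hσs hνσ hyo (hc y hyc) (hA y hyc)
      rw [← hf] at hL
      -- the formula: `L = F' ∘ DΞ₀` with `F'` the derivative of the tube chart at `q₀ = (thetaB y, e₀)`
      have hq₀ : ((b.baseLift ν (pt2 1 y), b.tubeNormal ν (pt2 1 y) + (0 : ℝ) • EuclideanSpace.single (1 : Fin 2) (1 : ℝ)) :
          ℝ × EuclideanSpace ℝ (Fin 2)) = (b.thetaB y, framingBaseVector) := by
        rw [zero_smul, add_zero, b.baseLift_pt2_one' ν (Ioo_subset_Icc_self hyo), b.tubeNormal_pt2_one ν (Ioo_subset_Icc_self hyo)]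
      have hdomF : IsOpen {q : ℝ × EuclideanSpace ℝ (Fin 2) | ν (circlePt q.1, q.2) ∈ σ.source} := isOpen_tubeChartDom ν (σ := σ)
      have hFd : DifferentiableAt ℝ (fun q : ℝ × EuclideanSpace ℝ (Fin 2) ↦ σ (ν (circlePt q.1, q.2))) (b.thetaB y, framingBaseVector) :=
        ((contDiffOn_tubeChart ν hσ).contDiffAt (hdomF.mem_nhds (hνσ _))).differentiableAt (by simp)
      set F' := fderiv ℝ (fun q : ℝ × EuclideanSpace ℝ (Fin 2) ↦ σ (ν (circlePt q.1, q.2))) (b.thetaB y, framingBaseVector) with hF'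
      have hFinj : Injective F' := injective_fderiv_tubeChart ν hσ hσs (hνσ _)
      -- `DΞ₀` and `DΞ₀♭`
      set DΞ := ((fderiv ℝ (b.baseLift ν) (pt2 1 y)).comp (ContinuousLinearMap.fst ℝ _ ℝ)).prod
        ((fderiv ℝ (b.tubeNormal ν) (pt2 1 y)).comp (ContinuousLinearMap.fst ℝ _ ℝ) +
          (ContinuousLinearMap.snd ℝ (EuclideanSpace ℝ (Fin 2)) ℝ).smulRight (EuclideanSpace.single (1 : Fin 2) (1 : ℝ))) with hDΞ
      set DΞb := (((deriv b.thetaB y) • ((EuclideanSpace.proj (1 : Fin 2)).comp (ContinuousLinearMap.fst ℝ _ ℝ))).prod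
        (((-b.edgeRate ν y) • ((EuclideanSpace.proj (0 : Fin 2)).comp (ContinuousLinearMap.fst ℝ _ ℝ))).smulRight
            framingBaseVector +
          (ContinuousLinearMap.snd ℝ (EuclideanSpace ℝ (Fin 2)) ℝ).smulRight (EuclideanSpace.single (1 : Fin 2) (1 : ℝ)))) with hDΞb
      have hΞ := b.hasFDerivAt_thickeningCoord ν (b.pt2_one_mem_baseLiftDom' ν hyo) 0
      have hΞb := b.hasFDerivAt_thickeningFlatCoord ν hyo
      -- chain rules: `f = F ∘ Ξ₀`, `fb = F ∘ Ξ₀♭`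
      have hfac : f = (fun q : ℝ × EuclideanSpace ℝ (Fin 2) ↦ σ (ν (circlePt q.1, q.2))) ∘
          (fun p : EuclideanSpace ℝ (Fin 2) × ℝ ↦ ((b.baseLift ν p.1,
            b.tubeNormal ν p.1 + p.2 • EuclideanSpace.single (1 : Fin 2) (1 : ℝ)) : ℝ × EuclideanSpace ℝ (Fin 2))) := by
        rw [hf]; funext p; rfl
      have hfacb : fb = (fun q : ℝ × EuclideanSpace ℝ (Fin 2) ↦ σ (ν (circlePt q.1, q.2))) ∘
          (fun p : EuclideanSpace ℝ (Fin 2) × ℝ ↦ ((b.thetaB (p.1 1),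
            (1 + (1 - p.1 0) * b.edgeRate ν (p.1 1)) • framingBaseVector +
              p.2 • EuclideanSpace.single (1 : Fin 2) (1 : ℝ)) : ℝ × EuclideanSpace ℝ (Fin 2))) := by
        rw [hfb]; funext p; rfl
      have hFd' : DifferentiableAt ℝ (fun q : ℝ × EuclideanSpace ℝ (Fin 2) ↦ σ (ν (circlePt q.1, q.2)))
          ((b.baseLift ν (pt2 1 y), b.tubeNormal ν (pt2 1 y) + (0 : ℝ) • EuclideanSpace.single (1 : Fin 2) (1 : ℝ)) :
            ℝ × EuclideanSpace ℝ (Fin 2)) := by rw [hq₀]; exact hFd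
      have hfD : HasFDerivAt f (F'.comp DΞ) (pt2 1 y, 0) := by
        have h := hFd'.hasFDerivAt.comp ((pt2 1 y : EuclideanSpace ℝ (Fin 2)), (0 : ℝ)) hΞ
        rw [← hfac] at h
        have hpt : fderiv ℝ (fun q : ℝ × EuclideanSpace ℝ (Fin 2) ↦ σ (ν (circlePt q.1, q.2)))
            ((b.baseLift ν (pt2 1 y), b.tubeNormal ν (pt2 1 y) + (0 : ℝ) • EuclideanSpace.single (1 : Fin 2) (1 : ℝ)) :
              ℝ × EuclideanSpace ℝ (Fin 2)) = F' := by rw [hF', hq₀]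
        rw [hpt] at h
        exact h
      have hq₀b : ((b.thetaB ((pt2 1 y : EuclideanSpace ℝ (Fin 2)) 1),
          (1 + (1 - (pt2 1 y : EuclideanSpace ℝ (Fin 2)) 0) * b.edgeRate ν ((pt2 1 y : EuclideanSpace ℝ (Fin 2)) 1)) • framingBaseVector +
            (0 : ℝ) • EuclideanSpace.single (1 : Fin 2) (1 : ℝ)) : ℝ × EuclideanSpace ℝ (Fin 2)) = (b.thetaB y, framingBaseVector) := by
        have h0 : (pt2 1 y : EuclideanSpace ℝ (Fin 2)) 0 = 1 := rfl
        have h1 : (pt2 1 y : EuclideanSpace ℝ (Fin 2)) 1 = y := rfl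
        rw [h0, h1, sub_self, zero_mul, add_zero, one_smul, zero_smul, add_zero]
      have hfbD : HasFDerivAt fb (F'.comp DΞb) (pt2 1 y, 0) := by
        have hFd'' : DifferentiableAt ℝ (fun q : ℝ × EuclideanSpace ℝ (Fin 2) ↦ σ (ν (circlePt q.1, q.2)))
            ((b.thetaB ((pt2 1 y : EuclideanSpace ℝ (Fin 2)) 1),
              (1 + (1 - (pt2 1 y : EuclideanSpace ℝ (Fin 2)) 0) * b.edgeRate ν ((pt2 1 y : EuclideanSpace ℝ (Fin 2)) 1)) •
                  framingBaseVector + (0 : ℝ) • EuclideanSpace.single (1 : Fin 2) (1 : ℝ)) : ℝ × EuclideanSpace ℝ (Fin 2)) := by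
          rw [hq₀b]; exact hFd
        have h := hFd''.hasFDerivAt.comp ((pt2 1 y : EuclideanSpace ℝ (Fin 2)), (0 : ℝ)) hΞb
        rw [← hfacb] at h
        have hpt : fderiv ℝ (fun q : ℝ × EuclideanSpace ℝ (Fin 2) ↦ σ (ν (circlePt q.1, q.2)))
            ((b.thetaB ((pt2 1 y : EuclideanSpace ℝ (Fin 2)) 1),
              (1 + (1 - (pt2 1 y : EuclideanSpace ℝ (Fin 2)) 0) * b.edgeRate ν ((pt2 1 y : EuclideanSpace ℝ (Fin 2)) 1)) •
                  framingBaseVector + (0 : ℝ) • EuclideanSpace.single (1 : Fin 2) (1 : ℝ)) : ℝ × EuclideanSpace ℝ (Fin 2)) = F' := by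
          rw [hF', hq₀b]
        rw [hpt] at h
        exact h
      -- `L = F' ∘ DΞ`
      have hLeq : (L : (EuclideanSpace ℝ (Fin 2) × ℝ) →L[ℝ] EuclideanSpace ℝ (Fin 3)) = F'.comp DΞ := hL.unique hfD
      -- derivative of `Φ⁻¹` at `z` and of `Q`
      have hp₀ : Φ.symm z = (pt2 1 y, 0) := by rw [hzf]; exact hΦsymm_edge y hyc
      have hΦL : HasFDerivAt Φ (L : (EuclideanSpace ℝ (Fin 2) × ℝ) →L[ℝ] EuclideanSpace ℝ (Fin 3)) (Φ.symm z) := by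
        rw [hp₀, hΦf]; exact hL
      have hsymmD : HasFDerivAt Φ.symm (L.symm : EuclideanSpace ℝ (Fin 3) →L[ℝ] EuclideanSpace ℝ (Fin 2) × ℝ) z :=
        Φ.hasFDerivAt_symm hzt hΦL
      have hQD : HasFDerivAt Q ((F'.comp DΞb).comp (L.symm : EuclideanSpace ℝ (Fin 3) →L[ℝ] EuclideanSpace ℝ (Fin 2) × ℝ)) z := by
        rw [hQ]
        have hfbD' : HasFDerivAt fb (F'.comp DΞb) (Φ.symm z) := by rw [hp₀]; exact hfbD
        exact hfbD'.comp z hsymmD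
      -- derivative of `P` at `z`
      set DQ := (F'.comp DΞb).comp (L.symm : EuclideanSpace ℝ (Fin 3) →L[ℝ] EuclideanSpace ℝ (Fin 2) × ℝ) with hDQ
      set D : EuclideanSpace ℝ (Fin 3) →L[ℝ] EuclideanSpace ℝ (Fin 3) :=
        ContinuousLinearMap.id ℝ _ + (ρ z) • (DQ - ContinuousLinearMap.id ℝ _) with hD
      have hPD : HasFDerivAt P D z := by
        rw [hP]
        have h1 : HasFDerivAt (fun w ↦ Q w - w) (DQ - ContinuousLinearMap.id ℝ _) z := hQD.sub (hasFDerivAt_id z)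
        have h2 := hasFDerivAt_smul_of_eq_zero (hρs.contDiffAt.differentiableAt (by simp)).hasFDerivAt h1
          (by rw [hQz, sub_self])
        exact (hasFDerivAt_id z).add h2
      refine ⟨D, hPD, fun t ht ↦ ?_⟩
      -- `slDeriv t D = F' ∘ ((1-s) DΞ + s DΞ♭) ∘ L⁻¹`, `s = t ρ z`
      set s := t * ρ z with hs
      have hLsymm : ∀ v, (L : (EuclideanSpace ℝ (Fin 2) × ℝ) →L[ℝ] EuclideanSpace ℝ (Fin 3)) (L.symm v) = v :=
        fun v ↦ L.apply_symm_apply v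
      have hkey : ∀ v, slDeriv t D v = F' (((1 - s) • DΞ + s • DΞb) (L.symm v)) := by
        intro v
        rw [slDeriv_apply]
        have e1 : D v = v + ρ z • (DQ v - v) := by
          simp only [hD, add_apply, ContinuousLinearMap.id_apply, FunLike.coe_smul,
            Pi.smul_apply, sub_apply]
        have e2 : DQ v = F' (DΞb (L.symm v)) := by simp only [hDQ, ContinuousLinearMap.coe_comp, comp_apply]; rfl
        have e3 : F' (DΞ (L.symm v)) = v := by
          have := hLsymm v
          rw [hLeq] at this
          simpa only [ContinuousLinearMap.coe_comp, comp_apply] using this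
        rw [e1, e2]
        rw [add_apply, FunLike.coe_smul, FunLike.coe_smul,
          Pi.smul_apply, Pi.smul_apply, map_add, map_smul, map_smul, e3]
        simp only [hs, mul_smul]
        module
      have hBinj := b.injective_convex_thickeningCoord ν hyo (hc y hyc) (hA y hyc) s
      intro v v' hvv
      rw [hkey, hkey] at hvv
      have h1 := hFinj hvv
      have h2 := hBinj h1
      exact L.symm.injective h2
    · -- on the rest: `P = id` near `z`
      have hzU : σ (ν.pushOff u) ∉ Uρ := fun h ↦ h.2 hrest
      have hzO : σ (ν.pushOff u) ∈ O₀ := hUO₀ hzU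
      refine ⟨ContinuousLinearMap.id ℝ _, ?_, fun t _ ↦ ?_⟩
      · have hev : P =ᶠ[𝓝 (σ (ν.pushOff u))] id :=
          Filter.eventuallyEq_of_mem (hO₀o.mem_nhds hzO) fun w hw ↦ hPO₀ w hw
        exact (hasFDerivAt_id _).congr_of_eventuallyEq hev
      · intro v v' h
        simpa [slDeriv_apply] using h
  exact ⟨P, G, hPs, hGo, hGseg, hGdom, hPfix, hderiv, hPflat⟩

end BandCore

end Literature.Topology.FourManifolds
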